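import Summits.ResolutionOfSingularities.ResolutionOfSingularities.Theorems.PurelyInseparableDim4ResConeYoungBoundary
import HarnessLib
import HarnessLib.Audit.Tags

/-!
# Purely inseparable four-folds — the TAME CONE AT A CONSTANT-`d` STEP, VII: the satellite calculus ALONG AN
# ISOLATED ABOVE-FLOOR CHAIN (chain forms of SAT-LOCATED / SAT-PREDICTED / SAT-UNIQUE / NO-YOUNG-CORNER)

[OURS · counted 0 · cell `res-dim4-pi` · desk WORD #66 (2) (K2(p) lower-band lane, owner p-12 g2) · seat
res-dim4-p-5 g2 · K lane crit-4 g2 (K-A4).]  Nothing here proves K2(p), `NoIsolatedTrap p p` or resolution of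
singularities in dimension ≥ 4 / characteristic `p`.

The step-lemmas of `…ResConeSatUnique` (p670004), `…ResConeSatLocated` (p670701) and `…ResConeYoungBoundary`
(p671226) are stated for two or three explicit `CentreBlowup.step`s with their band data.  Consumers of the K2(p)
ledger work with CHAINS: an isolated above-floor `Step0 p` chain `c` with `x^{r₀} ∣ F₀`, witnessed by charts and
chart points `(j k, b k)` (`FreeTail.IsWitnessedChain p c j b`, so `c (k+1) = step p univ (j k) (b k) (c k)`),
eventually of constant shade; `FreeTail.IsSatellite j b k :↔ j (k+1) ≠ j k ∧ b (k+1) (j k) = 0`.  This file does the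
band bookkeeping ONCE (`chain_band`, `chain_shade_step`) and restates, for every `k ≥ k₀` on the constant-shade tail:

* `chain_direction_mem_resVertex` ((VT)(i) along the chain);
* **`chain_direction_mem_resVertex_of_satellite`** (SAT-LOCATED): `IsSatellite j b k →
  direction (j (k+1)) (b (k+1)) ∈ resVertex (c k) ⊓ hyperplane (j k)`;
* **`chain_satellite_direction_eq_smul`** (SAT-PREDICTED, `e_G(c k) ≤ 2`): the satellite direction is
  `(u (j (k+1)))⁻¹ • u` for any non-zero `u ∈ resVertex (c k)` with `u (j k) = 0`;
* **`chain_direction_apply_ne_zero_of_satellite_satellite`**, **`chain_apply_ne_zero_of_satellite_satellite`**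
  (NO-YOUNG-CORNER, `e_G(c k) ≤ 2`): `IsSatellite j b k → IsSatellite j b (k+1) →
  direction (j (k+2)) (b (k+2)) (j k) ≠ 0` (and `j (k+2) ≠ j k → b (k+2) (j k) ≠ 0`).

[cite: CossartJannsenSaito2020, Thm. 3.10(4), Thm. 3.14, Thm. 9.3]
bears_on: LADDER-RESOLUTION:D157-DOOR2 (res-dim4-pi · K2(p) = `RidgeBudget.NoAboveFloorTrap p p`, lower band).
Supports stmt-ResolutionOfSingularities-16155 (helper).
-/

set_option linter.dupNamespace false -- mandated namespace of this single-conjunct summit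

noncomputable section

namespace Summit.ResolutionOfSingularities.ResolutionOfSingularities.Theorems.PIDim4

namespace ResCone

open MvPolynomial Finset
open Literature.AlgebraicGeometry.Resolution
open Literature.AlgebraicGeometry.Resolution.CentreBlowup
open Literature.AlgebraicGeometry.Resolution.Hauser2010
open Literature.AlgebraicGeometry.Resolution.HauserPerlega2019
open PointBlowup (polarMap additiveSubspace direction)

variable {K : Type} [Field K]

section Chain

variable (p : ℕ) [Fact p.Prime] [DecidableEq K]

/-- **Band data along an isolated above-floor chain**: every state has `p < ord₀ F < 2p`. [OURS] -/
theorem chain_band {c : ℕ → State K} (hc : ∀ k, IsIsolated p (c k).F ∧ Step0 p (c k) (c (k + 1)))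
    (hfloor : ∀ k, ordZero (c k).F ≠ p) (m : ℕ) :
    ∃ o : ℕ, ordZero (c m).F = o ∧ p < o ∧ o < 2 * p := by
  obtain ⟨o, ho, hpo, ho2⟩ := BandShade.exists_ordZero_eq p hc m
  refine ⟨o, ho, lt_of_le_of_ne hpo (fun h => hfloor m (by rw [ho, h])), ?_⟩
  have hp : 2 ≤ p := (Fact.out : p.Prime).two_le
  omega

omit [Fact p.Prime] in
/-- **The step read through the witnesses keeps the shade** on the constant-shade tail. [OURS] -/
theorem chain_shade_step {c : ℕ → State K} {j : ℕ → Fin 4} {b : ℕ → Fin 4 → K}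
    (hw : FreeTail.IsWitnessedChain p c j b) {k₀ : ℕ} {d : ℕ∞} (hshade : ∀ k, k₀ ≤ k → (c k).shade = d)
    {k : ℕ} (hk : k₀ ≤ k) :
    (CentreBlowup.step p Finset.univ (j k) (b k) (c k)).shade = (c k).shade := by
  rw [← (hw k).2.2.2.2, hshade (k + 1) (by omega), hshade k hk]

/-- **(VT)(i) along the chain**: on the constant-shade tail the direction of every step lies in the current
polar kernel. [OURS] [cite: CossartJannsenSaito2020, Thm. 3.14] -/
theorem chain_direction_mem_resVertex {c : ℕ → State K} {j : ℕ → Fin 4} {b : ℕ → Fin 4 → K}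
    (hc : ∀ k, IsIsolated p (c k).F ∧ Step0 p (c k) (c (k + 1))) (hw : FreeTail.IsWitnessedChain p c j b)
    (hr0 : ∀ e ∈ (c 0).F.support, (c 0).r ≤ e) (hfloor : ∀ k, ordZero (c k).F ≠ p) {k₀ : ℕ} {d : ℕ∞}
    (hshade : ∀ k, k₀ ≤ k → (c k).shade = d) {k : ℕ} (hk : k₀ ≤ k) :
    direction (j k) (b k) ∈ resVertex (c k) := by
  obtain ⟨o, ho, hpo, ho2⟩ := chain_band p hc hfloor k
  exact direction_mem_resVertex_of_shade_eq (j k) (hw k).2.1 ho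
    (IsolatedBand.isolated_chain_forall_le hc hr0 k) hpo ho2 (chain_shade_step p hw hshade hk)

/-- **(SAT-LOCATED) along the chain**: if step `k+1` is a satellite of step `k` (on the constant-shade tail), its
direction lies in the polar kernel of stage `k` cut by the exceptional hyperplane `{w_{j k} = 0}`. [OURS]
[cite: CossartJannsenSaito2020, Thm. 3.14] -/
theorem chain_direction_mem_resVertex_of_satellite {c : ℕ → State K} {j : ℕ → Fin 4} {b : ℕ → Fin 4 → K}
    (hc : ∀ k, IsIsolated p (c k).F ∧ Step0 p (c k) (c (k + 1))) (hw : FreeTail.IsWitnessedChain p c j b)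
    (hr0 : ∀ e ∈ (c 0).F.support, (c 0).r ≤ e) (hfloor : ∀ k, ordZero (c k).F ≠ p) {k₀ : ℕ} {d : ℕ∞}
    (hshade : ∀ k, k₀ ≤ k → (c k).shade = d) {k : ℕ} (hk : k₀ ≤ k) (hsat : FreeTail.IsSatellite j b k) :
    direction (j (k + 1)) (b (k + 1)) ∈ resVertex (c k) ⊓ hyperplane (j k) := by
  obtain ⟨o₀, ho₀, hpo₀, ho₀2⟩ := chain_band p hc hfloor k
  obtain ⟨o₁, ho₁, hpo₁, ho₁2⟩ := chain_band p hc hfloor (k + 1)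
  have hr := IsolatedBand.isolated_chain_forall_le hc hr0
  have hck := (hw k).2.2.2.2
  have heq₀ := chain_shade_step p hw hshade hk
  have heq₁ := chain_shade_step p hw hshade (show k₀ ≤ k + 1 by omega)
  have hr₁ := hr (k + 1)
  rw [hck] at ho₁ hr₁ heq₁
  exact direction_mem_resVertex_of_satellite (hw k).2.1 (hw (k + 1)).2.1 ho₀ (hr k) hpo₀ ho₀2 heq₀ ho₁ hr₁
    hpo₁ ho₁2 heq₁ hsat

/-- **(SAT-PREDICTED) along the chain** (`e_G(c k) ≤ 2`): the satellite direction of step `k+1` is the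
normalisation of ANY non-zero `u ∈ resVertex (c k)` with `u (j k) = 0`. [OURS] [cite: CossartJannsenSaito2020, Thm. 3.14] -/
theorem chain_satellite_direction_eq_smul {c : ℕ → State K} {j : ℕ → Fin 4} {b : ℕ → Fin 4 → K}
    (hc : ∀ k, IsIsolated p (c k).F ∧ Step0 p (c k) (c (k + 1))) (hw : FreeTail.IsWitnessedChain p c j b)
    (hr0 : ∀ e ∈ (c 0).F.support, (c 0).r ≤ e) (hfloor : ∀ k, ordZero (c k).F ≠ p) {k₀ : ℕ} {d : ℕ∞}
    (hshade : ∀ k, k₀ ≤ k → (c k).shade = d) {k : ℕ} (hk : k₀ ≤ k) (hsat : FreeTail.IsSatellite j b k)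
    (he : Module.finrank K (resVertex (c k)) ≤ 2) {u : Fin 4 → K} (hu : u ∈ resVertex (c k))
    (huj : u (j k) = 0) (hu0 : u ≠ 0) :
    u (j (k + 1)) ≠ 0 ∧ direction (j (k + 1)) (b (k + 1)) = (u (j (k + 1)))⁻¹ • u := by
  obtain ⟨o₀, ho₀, hpo₀, ho₀2⟩ := chain_band p hc hfloor k
  obtain ⟨o₁, ho₁, hpo₁, ho₁2⟩ := chain_band p hc hfloor (k + 1)
  have hr := IsolatedBand.isolated_chain_forall_le hc hr0
  have hck := (hw k).2.2.2.2
  have heq₀ := chain_shade_step p hw hshade hk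
  have heq₁ := chain_shade_step p hw hshade (show k₀ ≤ k + 1 by omega)
  have hr₁ := hr (k + 1)
  rw [hck] at ho₁ hr₁ heq₁
  exact satellite_direction_eq_smul_of_mem_resVertex (hw k).2.1 (hw (k + 1)).2.1 ho₀ (hr k) hpo₀ ho₀2 heq₀
    ho₁ hr₁ hpo₁ ho₁2 heq₁ hsat he hu huj hu0

/-- **(SAT-UNIQUE) along the chain, as a function of the stage** (`e_G(c k) ≤ 2`): two chains that agree up to
stage `k + 1` and both take a satellite step there take THE SAME direction — phrased for one chain: the satellite
direction of step `k+1` is determined by `resVertex (c k)` and `j k`; concretely any two admissible satellite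
data `(j₁, b₁)`, `(j₂, b₂)` out of `c (k+1)` are proportional.  (Direct re-export of
`satellite_directions_dependent_of_finrank_le_two` with the chain's band data.) [OURS]
[cite: CossartJannsenSaito2020, Thm. 3.14] -/
theorem chain_satellite_directions_dependent {c : ℕ → State K} {j : ℕ → Fin 4} {b : ℕ → Fin 4 → K}
    (hc : ∀ k, IsIsolated p (c k).F ∧ Step0 p (c k) (c (k + 1))) (hw : FreeTail.IsWitnessedChain p c j b)
    (hr0 : ∀ e ∈ (c 0).F.support, (c 0).r ≤ e) (hfloor : ∀ k, ordZero (c k).F ≠ p) {k₀ : ℕ} {d : ℕ∞}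
    (hshade : ∀ k, k₀ ≤ k → (c k).shade = d) {k : ℕ} (hk : k₀ ≤ k)
    (he : Module.finrank K (resVertex (c k)) ≤ 2) {j₂ : Fin 4} {b₂ : Fin 4 → K} (hb₂ : b₂ j₂ = 0)
    (heq₂ : (CentreBlowup.step p Finset.univ j₂ b₂ (c (k + 1))).shade = (c (k + 1)).shade)
    (hsat : FreeTail.IsSatellite j b k) (hsat₂ : j₂ ≠ j k ∧ b₂ (j k) = 0) :
    ∃ a : K, direction j₂ b₂ = a • direction (j (k + 1)) (b (k + 1)) := by
  obtain ⟨o₀, ho₀, hpo₀, ho₀2⟩ := chain_band p hc hfloor k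
  obtain ⟨o₁, ho₁, hpo₁, ho₁2⟩ := chain_band p hc hfloor (k + 1)
  have hr := IsolatedBand.isolated_chain_forall_le hc hr0
  have hck := (hw k).2.2.2.2
  have heq₀ := chain_shade_step p hw hshade hk
  have heq₁ := chain_shade_step p hw hshade (show k₀ ≤ k + 1 by omega)
  have hr₁ := hr (k + 1)
  have heq₂' := heq₂
  rw [hck] at ho₁ hr₁ heq₁ heq₂'
  exact satellite_directions_dependent_of_finrank_le_two (hw k).2.1 (hw (k + 1)).2.1 hb₂ ho₀ (hr k) hpo₀ ho₀2
    heq₀ ho₁ hr₁ hpo₁ ho₁2 heq₁ heq₂' hsat hsat₂ he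

/-- **(NO-YOUNG-CORNER) along the chain** (`e_G(c k) ≤ 2`): two consecutive satellite steps `k+1`, `k+2` force
`direction (j (k+2)) (b (k+2)) (j k) ≠ 0` — the divisor created at step `k` is LOST at step `k+2`. [OURS]
[cite: CossartJannsenSaito2020, Thm. 3.10(4), Thm. 3.14, Thm. 9.3] -/
theorem chain_direction_apply_ne_zero_of_satellite_satellite {c : ℕ → State K} {j : ℕ → Fin 4}
    {b : ℕ → Fin 4 → K} (hc : ∀ k, IsIsolated p (c k).F ∧ Step0 p (c k) (c (k + 1)))
    (hw : FreeTail.IsWitnessedChain p c j b) (hr0 : ∀ e ∈ (c 0).F.support, (c 0).r ≤ e)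
    (hfloor : ∀ k, ordZero (c k).F ≠ p) {k₀ : ℕ} {d : ℕ∞} (hshade : ∀ k, k₀ ≤ k → (c k).shade = d) {k : ℕ}
    (hk : k₀ ≤ k) (he : Module.finrank K (resVertex (c k)) ≤ 2) (hsat₁ : FreeTail.IsSatellite j b k)
    (hsat₂ : FreeTail.IsSatellite j b (k + 1)) : direction (j (k + 2)) (b (k + 2)) (j k) ≠ 0 := by
  obtain ⟨o₀, ho₀, hpo₀, ho₀2⟩ := chain_band p hc hfloor k
  obtain ⟨o₁, ho₁, hpo₁, ho₁2⟩ := chain_band p hc hfloor (k + 1)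
  obtain ⟨o₂, ho₂, hpo₂, ho₂2⟩ := chain_band p hc hfloor (k + 2)
  have hr := IsolatedBand.isolated_chain_forall_le hc hr0
  have hck := (hw k).2.2.2.2
  have hck1 := (hw (k + 1)).2.2.2.2
  have heq₀ := chain_shade_step p hw hshade hk
  have heq₁ := chain_shade_step p hw hshade (show k₀ ≤ k + 1 by omega)
  have heq₂ := chain_shade_step p hw hshade (show k₀ ≤ k + 2 by omega)
  have hr₁ := hr (k + 1)
  have hr₂ := hr (k + 2)
  rw [hck1] at ho₂ hr₂ heq₂
  rw [hck] at ho₁ hr₁ heq₁ ho₂ hr₂ heq₂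
  exact direction_apply_ne_zero_of_satellite_satellite (hw k).2.1 (hw (k + 1)).2.1 (hw (k + 2)).2.1 ho₀ (hr k)
    hpo₀ ho₀2 heq₀ ho₁ hr₁ hpo₁ ho₁2 heq₁ ho₂ hr₂ hpo₂ ho₂2 heq₂ hsat₁ hsat₂ he

/-- **(NO-YOUNG-CORNER), chart-point form along the chain**: with `j (k+2) ≠ j k` the chart point has
`b (k+2) (j k) ≠ 0`. [OURS] [cite: CossartJannsenSaito2020, Thm. 3.14] -/
theorem chain_apply_ne_zero_of_satellite_satellite {c : ℕ → State K} {j : ℕ → Fin 4} {b : ℕ → Fin 4 → K}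
    (hc : ∀ k, IsIsolated p (c k).F ∧ Step0 p (c k) (c (k + 1))) (hw : FreeTail.IsWitnessedChain p c j b)
    (hr0 : ∀ e ∈ (c 0).F.support, (c 0).r ≤ e) (hfloor : ∀ k, ordZero (c k).F ≠ p) {k₀ : ℕ} {d : ℕ∞}
    (hshade : ∀ k, k₀ ≤ k → (c k).shade = d) {k : ℕ} (hk : k₀ ≤ k)
    (he : Module.finrank K (resVertex (c k)) ≤ 2) (hsat₁ : FreeTail.IsSatellite j b k)
    (hsat₂ : FreeTail.IsSatellite j b (k + 1)) (hj : j (k + 2) ≠ j k) : b (k + 2) (j k) ≠ 0 := by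
  have h := chain_direction_apply_ne_zero_of_satellite_satellite p hc hw hr0 hfloor hshade hk he hsat₁ hsat₂
  rwa [direction_apply_of_ne (Ne.symm hj)] at h

end Chain

end ResCone

end Summit.ResolutionOfSingularities.ResolutionOfSingularities.Theorems.PIDim4

end
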